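import Summits.Ventures.YMGap.Conjectures.StrongCouplingChiralLROSchwingerDysonSmallBeta
import HarnessLib
import HarnessLib.Audit.Tags

/-!
# Venture YMGap — Conjectures/StrongCouplingChiralLRORegularPart.lean: the open input of the typed Y3
# conjecture is ONE number per volume — the regular part of the nearest-neighbour chiral correlation

HONEST FRAMING (venture `Summits/Ventures/YMGap`, cell `pub-ymgap`, seat qcd-lit g20, `bears_on: Q1`).  The
conjecture `Summit.Ventures.YMGap.Conjectures.SalmhoferSeilerSmallBeta` (`Conjectures/StrongCouplingChiralLRO.lean`)
is NOT proved here and remains open.  `…SchwingerDysonSmallBeta` reduced it to the volume-uniform MODE-WISE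
infrared bound (IR)_{β,4N+ε} (row S3 of the cell memo `run/shared/lean/pub/pub-ymgap/qcd-lit/Y3-INPUTS-INPRINT.md`)
at small `β`; this file records the weakest form in which Salmhofer–Seiler's step (4.12)–(4.14) consumes an
infrared bound, for the conjecture's kernel `T_β = ssTwoPoint N ν L β 0` at EVERY `β`:

* **`ssNbrSum_eq_order_add_regular`** — on the even torus `Λ = (ℤ/Lℤ)^ν`, at every real `β`,
  `∑_μ (T_β(e_μ) + T_β(-e_μ)) = 4ν · ssChiralOrder N ν L β + ρ_β(L)`, where the REGULAR PART
  `ρ_β(L) := |Λ|⁻¹ ∑_{k ∉ {0, π̂}} 2C(k) T̂_β(k)` (written out as an explicit sum over the characters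
  `χ ∉ {0, π̂}`; no definition is introduced) is `2ν ×` (the mean of `T_β` over the `2ν` nearest neighbours
  of `0` minus its mean over the odd sublattice) — translation invariance, symmetry and the `m = 0` chiral
  grading, all valid at every `β` (`StrongCouplingChiralLROReduction`, `…EveryCoupling`);
* **`ssChiralOrder_ge_of_regularPart`** — at every `β`: (SD)_{β,b} and `ρ_β(L) ≤ r` give
  `ssChiralOrder N ν L β ≥ (1/4ν)(b - r)`;
* **`regularPart_le_of_infraredBound_slack`** — at every `β`: a mode-wise infrared bound WITH SLACK,
  `2(ν ∓ C(χ))(±T̂_β(χ)) ≤ A + e(χ)` off `{0, π̂}`, gives `ρ_β(L) ≤ 2A·S_Λ(ν) + |Λ|⁻¹∑_{χ ∉ {0,π̂}} e(χ)·modeTerm(C(χ))`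
  (`modeTerm(c) = |c|/(ν - |c|)`, the folded integrand of (4.3)); **`regularPart_zero_le`** — at `β = 0`,
  `ρ_0(L) ≤ 8N·S_Λ(ν)` for every `N ≥ 1` (Thm. 3.21 with Remark 4.5, tree `infraredBound_zero_of_one_le`);
* **`salmhoferSeilerSmallBeta_of_regularPart`** — THE SHARPENED REDUCTION: `SalmhoferSeilerSmallBeta` follows
  as soon as, for every `1 ≤ N ≤ 4`, `ν ≥ 4`, there are `r < (2N)²/K(N)`, `β₁ > 0` and `L₀` with `ρ_β(L) ≤ r`
  for all `0 ≤ β < β₁` and all even `L ≥ L₀` (row S4 being the theorem `schwingerDysonBound_smallBeta`).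
  No infrared bound mode by mode, no constant `S(ν)`: what is open is an upper bound, uniform in the volume
  at small `β`, on the EXCESS of the nearest-neighbour chiral correlation over the long-range order, by
  anything less than the Schwinger–Dyson constant `(2N)²/K(N)`; at `β = 0` the printed infrared bound
  supplies `r = 8N·S(ν) + o(1) < (2N)²/K(N)` (`zeroCoupling_margin`); **`salmhoferSeilerSmallBeta_of_nbrExcess`**
  — the same hypothesis in position space, `∑_μ (T_β(e_μ) + T_β(-e_μ)) ≤ 4ν·ssChiralOrder N ν L β + r`;
* **`salmhoferSeilerSmallBeta_of_infraredBound_slack`** — in particular a mode-wise infrared bound at small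
  `β` whose slack `e(χ) ≥ 0` is NOT uniformly small but has small `C/D`-weighted average,
  `|Λ|⁻¹∑ e·modeTerm ≤ η` with `2A·S(ν) + η < (2N)²/K(N)`, suffices (e.g. slack concentrated on finitely
  many modes, or `e(k) ≍ β/D(k)` in dimension `ν ≥ 5`, where `|Λ|⁻¹∑ C/D² ` stays bounded);
* **`ssNbrSum_zero_one_eq_four`**, **`regularPart_zero_one_eq`**, `four_nu_mul_ssChiralOrder_zero_one_ge` —
  compact QED (`N = 1`) at `β = 0`: the Schwinger–Dyson bound is an EQUALITY, `∑_μ (T_0(e_μ) + T_0(-e_μ)) = 4`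
  on every even torus ((3.46) with `L = 0` has the single term `k = 1`; every dimer cover meets the origin
  once), hence `ρ_0(L) = 4 - 4ν·ssChiralOrder 1 ν L 0` and `4ν·ssChiralOrder 1 ν L 0 ≥ 4 - 8S_Λ(ν)`: for
  `N = 1` the regular part and the order parameter are complementary and the whole `β = 0` margin is the
  infrared estimate.

WHAT THIS IS NOT: no bound at any `β > 0`; nothing about `SU(N)`, Wilson fermions, the continuum,
`IsChiralAtZero`, a mass gap, or the Clay problem.  Theorems only (hypotheses spelled out as binders); no
definitions, no facts, no `sorry`.

References: M. Salmhofer, E. Seiler, Commun. Math. Phys. 139 (1991) 395–432: (3.106), (3.112)–(3.113),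
Thm. 3.21, Def. 4.1 (4.3), (4.12)–(4.14), Thm. 4.8 (4.38)–(4.42), Cor. 4.9 [SalmhoferSeiler1991].
-/

noncomputable section

namespace Summit.Ventures.YMGap.Conjectures

open Finset
open Literature.MathematicalPhysics.StatisticalMechanics
open Literature.Probability.LatticeModels (TorusSite)

/-! ### The nearest-neighbour sum = `4ν ×` order parameter + regular part, at every `β` -/

/-- The chiral grading hypothesis of the kernel lemmas for the conjecture's kernel: `T_β(0, z) = 0` on even
sites, at every real `β`. [cite: SalmhoferSeiler1991, (3.101) and (3.106)] -/
theorem ssTwoPoint_massless_graded (N ν L : ℕ) [NeZero L] (hν : 1 ≤ ν) (hL : Even L) (β : ℝ)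
    (z : TorusSite ν L) (hz : ComplexSpin.parity hL.two_dvd z = 0) : ssTwoPoint N ν L β 0 0 z = 0 := by
  refine ssTwoPoint_massless_eq_zero_of_sgn_eq N ν L hν hL.two_dvd β ?_
  rw [ComplexSpin.sgn_zero]
  unfold ComplexSpin.sgn
  rw [if_pos hz]

/-- **`∑_μ (T_β(e_μ) + T_β(-e_μ)) = 4ν · ssChiralOrder N ν L β + ρ_β(L)`** at every real `β` on the even torus
`(ℤ/Lℤ)^ν` (`ν ≥ 1`), with the regular part `ρ_β(L) = |Λ|⁻¹∑_{χ ∉ {0,π̂}} T̂_β(χ)·2C(χ)` — (4.12)–(4.13)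
with the two atoms `χ = 0, π̂` split off and identified, by the chiral grading, with `4ν ×` the order
parameter. [cite: SalmhoferSeiler1991, (4.12)–(4.14) with (3.106)] -/
theorem ssNbrSum_eq_order_add_regular (N ν L : ℕ) [NeZero L] (hν : 1 ≤ ν) (hL : Even L) (β : ℝ) :
    ∑ μ : Fin ν, (ssTwoPoint N ν L β 0 0 (Pi.single μ 1) + ssTwoPoint N ν L β 0 0 (-Pi.single μ 1)) =
      4 * ν * ssChiralOrder N ν L β +
        ((L : ℝ) ^ ν)⁻¹ *
          ∑ χ ∈ (Finset.univ.erase (0 : AddChar (TorusSite ν L) ℂ)).erase (ComplexSpin.stagChar hL.two_dvd),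
            (ComplexSpin.kernelSymbol (fun x y => ssTwoPoint N ν L β 0 x y) χ).re * (2 * ComplexSpin.cosSum χ) := by
  have hcard : (Fintype.card (TorusSite ν L) : ℝ) = (L : ℝ) ^ ν := by
    rw [Fintype.card_fun, ZMod.card, Fintype.card_fin, Nat.cast_pow]
  have h := ComplexSpin.sum_kernel_nbr_eq_order_add_regular (G := fun x y => ssTwoPoint N ν L β 0 x y) hν hL
    (fun x y a => ssTwoPoint_massless_add N ν L hL β x y a) (fun x y => ssTwoPoint_massless_comm N ν L β x y)
    (ssTwoPoint_massless_graded N ν L hν hL β)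
  rw [hcard] at h
  unfold ssChiralOrder
  exact h

/-! ### Long-range order from (SD) and a bound on the regular part, at every `β` -/

/-- **At every `β`**: the Schwinger–Dyson bound (SD)_{β,b} `b ≤ ∑_μ (T_β(e_μ) + T_β(-e_μ))` and a bound
`ρ_β(L) ≤ r` on the regular part give `ssChiralOrder N ν L β ≥ (1/4ν)(b - r)` (even torus, `ν ≥ 1`). [cite: SalmhoferSeiler1991, Thm. 4.8 ((4.40)–(4.42)) with (4.12)–(4.14)] -/
theorem ssChiralOrder_ge_of_regularPart (N ν L : ℕ) [NeZero L] (hν : 1 ≤ ν) (hL : Even L) {β b r : ℝ}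
    (hREG : ((L : ℝ) ^ ν)⁻¹ *
        ∑ χ ∈ (Finset.univ.erase (0 : AddChar (TorusSite ν L) ℂ)).erase (ComplexSpin.stagChar hL.two_dvd),
          (ComplexSpin.kernelSymbol (fun x y => ssTwoPoint N ν L β 0 x y) χ).re * (2 * ComplexSpin.cosSum χ) ≤ r)
    (hSD : b ≤ ∑ μ : Fin ν, (ssTwoPoint N ν L β 0 0 (Pi.single μ 1) + ssTwoPoint N ν L β 0 0 (-Pi.single μ 1))) :
    1 / (4 * ν) * (b - r) ≤ ssChiralOrder N ν L β := by
  have h := ComplexSpin.kernel_chiralLRO_of_regularPart' (G := fun x y => ssTwoPoint N ν L β 0 x y) hν hL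
    (fun x y a => ssTwoPoint_massless_add N ν L hL β x y a) (fun x y => ssTwoPoint_massless_comm N ν L β x y)
    (ssTwoPoint_massless_graded N ν L hν hL β) hREG hSD
  unfold ssChiralOrder
  exact h

/-- **At every `β`**: a mode-wise infrared bound WITH SLACK, `2(ν - C(χ))T̂_β(χ) ≤ A + e(χ)` and
`-2(ν + C(χ))T̂_β(χ) ≤ A + e(χ)` for all characters with `-ν < C(χ) < ν` (i.e. `χ ∉ {0, π̂}`), bounds the
regular part: `ρ_β(L) ≤ 2A·S_Λ(ν) + |Λ|⁻¹∑_{χ ∉ {0,π̂}} e(χ)·modeTerm(C(χ))`. [cite: SalmhoferSeiler1991, (4.14) with (3.112)–(3.113)] -/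
theorem regularPart_le_of_infraredBound_slack (N ν L : ℕ) [NeZero L] (hν : 1 ≤ ν) (hL : Even L) {β A : ℝ}
    {e : AddChar (TorusSite ν L) ℂ → ℝ}
    (hIR : ∀ χ : AddChar (TorusSite ν L) ℂ, -(ν : ℝ) < ComplexSpin.cosSum χ → ComplexSpin.cosSum χ < ν →
      2 * ((ν : ℝ) - ComplexSpin.cosSum χ) *
          (ComplexSpin.kernelSymbol (fun x y => ssTwoPoint N ν L β 0 x y) χ).re ≤ A + e χ ∧
        2 * ((ν : ℝ) + ComplexSpin.cosSum χ) *
          (-(ComplexSpin.kernelSymbol (fun x y => ssTwoPoint N ν L β 0 x y) χ).re) ≤ A + e χ) :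
    ((L : ℝ) ^ ν)⁻¹ *
        ∑ χ ∈ (Finset.univ.erase (0 : AddChar (TorusSite ν L) ℂ)).erase (ComplexSpin.stagChar hL.two_dvd),
          (ComplexSpin.kernelSymbol (fun x y => ssTwoPoint N ν L β 0 x y) χ).re * (2 * ComplexSpin.cosSum χ) ≤
      2 * A * ComplexSpin.latticeS ν L +
        ((L : ℝ) ^ ν)⁻¹ *
          ∑ χ ∈ (Finset.univ.erase (0 : AddChar (TorusSite ν L) ℂ)).erase (ComplexSpin.stagChar hL.two_dvd),
            e χ * ComplexSpin.modeTerm ν (ComplexSpin.cosSum χ) := by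
  have hcard : (Fintype.card (TorusSite ν L) : ℝ) = (L : ℝ) ^ ν := by
    rw [Fintype.card_fun, ZMod.card, Fintype.card_fin, Nat.cast_pow]
  have hn : (0 : ℝ) < (L : ℝ) ^ ν := by rw [← hcard]; exact Nat.cast_pos.2 Fintype.card_pos
  have hreg := ComplexSpin.regular_le_of_slack (G := fun x y => ssTwoPoint N ν L β 0 x y) hν hL (A := A) (e := e)
    (fun χ h0 hε => hIR χ (ComplexSpin.neg_lt_cosSum_of_ne_stagChar hL.two_dvd hε)
      (ComplexSpin.cosSum_lt_of_ne_zero h0))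
  rw [hcard] at hreg
  have hmono := mul_le_mul_of_nonneg_left hreg (inv_nonneg.mpr hn.le)
  have hexp : ((L : ℝ) ^ ν)⁻¹ * (2 * A * ((L : ℝ) ^ ν * ComplexSpin.latticeS ν L) +
      ∑ χ ∈ (Finset.univ.erase (0 : AddChar (TorusSite ν L) ℂ)).erase (ComplexSpin.stagChar hL.two_dvd),
        e χ * ComplexSpin.modeTerm ν (ComplexSpin.cosSum χ)) =
      2 * A * ComplexSpin.latticeS ν L + ((L : ℝ) ^ ν)⁻¹ *
        ∑ χ ∈ (Finset.univ.erase (0 : AddChar (TorusSite ν L) ℂ)).erase (ComplexSpin.stagChar hL.two_dvd),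
          e χ * ComplexSpin.modeTerm ν (ComplexSpin.cosSum χ) := by
    field_simp
  rw [hexp] at hmono
  exact hmono

/-- **At `β = 0` the regular part is at most `8N·S_Λ(ν)`**, for every `N ≥ 1`, on every even torus (`ν ≥ 1`):
the printed infrared bound Thm. 3.21 (tree `infraredBound_zero_of_one_le`, `A = 4N` in the normalisation
`ψ̄ψ = 2Nσ`, no slack). [cite: SalmhoferSeiler1991, Thm. 3.21 with (3.112)–(3.113) and (4.14)] -/
theorem regularPart_zero_le (N ν L : ℕ) [NeZero L] (hN1 : 1 ≤ N) (hν : 1 ≤ ν) (hL : Even L) :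
    ((L : ℝ) ^ ν)⁻¹ *
        ∑ χ ∈ (Finset.univ.erase (0 : AddChar (TorusSite ν L) ℂ)).erase (ComplexSpin.stagChar hL.two_dvd),
          (ComplexSpin.kernelSymbol (fun x y => ssTwoPoint N ν L 0 0 x y) χ).re * (2 * ComplexSpin.cosSum χ) ≤
      8 * N * ComplexSpin.latticeS ν L := by
  have h := regularPart_le_of_infraredBound_slack N ν L hν hL (β := 0) (A := 4 * N) (e := fun _ => 0)
    (fun χ _ _ => by
      obtain ⟨h1, h2⟩ := infraredBound_zero_of_one_le (ν := ν) (L := L) hN1 hν hL χ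
      exact ⟨by rw [add_zero]; exact h1, by rw [add_zero]; exact h2⟩)
  simp only [zero_mul, Finset.sum_const_zero, mul_zero, add_zero] at h
  linarith

/-! ### The sharpened reduction: Y3 ⇐ a volume-uniform bound on the regular part at small `β` -/

/-- **SHARPENED REDUCTION OF Y3.**  `SalmhoferSeilerSmallBeta` follows as soon as, for every `1 ≤ N ≤ 4`,
`ν ≥ 4`, there are `r < (2N)²/K(N)` (Remark 4.6's `K`: `1, 2, 10/3, 83/15`), `β₁ > 0` and `L₀` such that the
regular part of the nearest-neighbour chiral correlation obeys `ρ_β(L) ≤ r` for all `0 ≤ β < β₁` and all even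
`L ≥ L₀` — the Schwinger–Dyson half being the tree's theorem `schwingerDysonBound_smallBeta` (row S4, uniform
in `L`).  This hypothesis is implied by the mode-wise infrared bound (IR)_{β,4N+ε} of
`salmhoferSeilerSmallBeta_of_infraredBound` (with `r = 2(4N+ε)(S(ν)+o(1))`, `zeroCoupling_margin`) and is
the weakest statement the printed mechanism consumes.  Not in print for any `β > 0`; nothing here claims it. [cite: SalmhoferSeiler1991, Thm. 4.8 ((4.38)–(4.42)) and Cor. 4.9] -/
theorem salmhoferSeilerSmallBeta_of_regularPart
    (h : ∀ N ν : ℕ, 1 ≤ N → N ≤ 4 → 4 ≤ ν →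
      ∃ r : ℝ, r < (2 * N : ℝ) ^ 2 / ComplexSpin.sdK N (ComplexSpin.uNLogCoeff N) ∧
        ∃ β₁ : ℝ, 0 < β₁ ∧ ∃ L₀ : ℕ, ∀ β : ℝ, 0 ≤ β → β < β₁ →
          ∀ (L : ℕ) [NeZero L] (hL : Even L), L₀ ≤ L →
            ((L : ℝ) ^ ν)⁻¹ *
                ∑ χ ∈ (Finset.univ.erase (0 : AddChar (TorusSite ν L) ℂ)).erase (ComplexSpin.stagChar hL.two_dvd),
                  (ComplexSpin.kernelSymbol (fun x y => ssTwoPoint N ν L β 0 x y) χ).re *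
                    (2 * ComplexSpin.cosSum χ) ≤ r) :
    SalmhoferSeilerSmallBeta := by
  intro N ν hN1 hN4 hν
  obtain ⟨r, hr, β₁, hβ₁, L₀, hL₀⟩ := h N ν hN1 hN4 hν
  have hν1 : 1 ≤ ν := by omega
  have hνpos : (0 : ℝ) < ν := by exact_mod_cast hν1
  set b₀ : ℝ := (2 * N : ℝ) ^ 2 / ComplexSpin.sdK N (ComplexSpin.uNLogCoeff N) with hb₀
  have hε : 0 < (b₀ - r) / 2 := by linarith
  obtain ⟨β₂, hβ₂, hSD⟩ := SchwingerDyson.schwingerDysonBound_smallBeta (ν := ν) hN1 hN4 hν1 hε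
  refine ⟨min β₁ β₂, lt_min hβ₁ hβ₂, 1 / (4 * ν) * ((b₀ - r) / 2), by positivity, L₀,
    fun β hβ hβlt L _ hE hLe => ?_⟩
  have hREG := hL₀ β hβ (hβlt.trans_le (min_le_left _ _)) L hE hLe
  have hS := hSD β hβ (hβlt.trans_le (min_le_right _ _)) L hE
  have hmain := ssChiralOrder_ge_of_regularPart N ν L hν1 hE hREG hS
  have heq : b₀ - (b₀ - r) / 2 - r = (b₀ - r) / 2 := by ring
  rw [heq] at hmain
  exact hmain

/-- **The same reduction in position space (no Fourier analysis in the hypothesis).**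
`SalmhoferSeilerSmallBeta` follows as soon as, for every `1 ≤ N ≤ 4`, `ν ≥ 4`, there are `r < (2N)²/K(N)`,
`β₁ > 0` and `L₀` such that for all `0 ≤ β < β₁` and all even `L ≥ L₀` the nearest-neighbour chiral
correlation exceeds `4ν ×` the order parameter by at most `r`:
`∑_μ (T_β(e_μ) + T_β(-e_μ)) ≤ 4ν · ssChiralOrder N ν L β + r` (the excess IS the regular part `ρ_β(L)`,
`ssNbrSum_eq_order_add_regular`).  In words: what is open is that, at small `β` uniformly in the volume,
the nearest-neighbour `⟨ψ̄ψ(0)ψ̄ψ(e_μ)⟩` correlation is carried by the long-range order up to a remainder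
smaller than the Schwinger–Dyson constant; at `β = 0` the remainder is `≤ 8N·S_Λ(ν)` (`regularPart_zero_le`). [cite: SalmhoferSeiler1991, Thm. 4.8 ((4.38)–(4.42)) and Cor. 4.9] -/
theorem salmhoferSeilerSmallBeta_of_nbrExcess
    (h : ∀ N ν : ℕ, 1 ≤ N → N ≤ 4 → 4 ≤ ν →
      ∃ r : ℝ, r < (2 * N : ℝ) ^ 2 / ComplexSpin.sdK N (ComplexSpin.uNLogCoeff N) ∧
        ∃ β₁ : ℝ, 0 < β₁ ∧ ∃ L₀ : ℕ, ∀ β : ℝ, 0 ≤ β → β < β₁ →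
          ∀ (L : ℕ) [NeZero L], Even L → L₀ ≤ L →
            ∑ μ : Fin ν, (ssTwoPoint N ν L β 0 0 (Pi.single μ 1) + ssTwoPoint N ν L β 0 0 (-Pi.single μ 1)) ≤
              4 * ν * ssChiralOrder N ν L β + r) :
    SalmhoferSeilerSmallBeta := by
  intro N ν hN1 hN4 hν
  obtain ⟨r, hr, β₁, hβ₁, L₀, hL₀⟩ := h N ν hN1 hN4 hν
  have hν1 : 1 ≤ ν := by omega
  have hνpos : (0 : ℝ) < ν := by exact_mod_cast hν1
  set b₀ : ℝ := (2 * N : ℝ) ^ 2 / ComplexSpin.sdK N (ComplexSpin.uNLogCoeff N) with hb₀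
  have hε : 0 < (b₀ - r) / 2 := by linarith
  obtain ⟨β₂, hβ₂, hSD⟩ := SchwingerDyson.schwingerDysonBound_smallBeta (ν := ν) hN1 hN4 hν1 hε
  refine ⟨min β₁ β₂, lt_min hβ₁ hβ₂, 1 / (4 * ν) * ((b₀ - r) / 2), by positivity, L₀,
    fun β hβ hβlt L _ hE hLe => ?_⟩
  have hEX := hL₀ β hβ (hβlt.trans_le (min_le_left _ _)) L hE hLe
  have hS := hSD β hβ (hβlt.trans_le (min_le_right _ _)) L hE
  rw [div_mul_eq_mul_div, div_le_iff₀ (by positivity : (0 : ℝ) < 4 * ν)]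
  linarith

/-- **Y3 from an infrared bound WITH SLACK.**  `SalmhoferSeilerSmallBeta` follows as soon as, for every
`1 ≤ N ≤ 4`, `ν ≥ 4`, there are constants `A ≥ 0`, `η` with `2A·S(ν) + η < (2N)²/K(N)` (`S(ν)` the printed
constant (4.3)), `β₁ > 0` and `L₀` such that for all `0 ≤ β < β₁` and all even `L ≥ L₀` the conjecture's kernel
obeys a mode-wise infrared bound `2(ν ∓ C(χ))(±T̂_β(χ)) ≤ A + e(χ)` off `{0, π̂}` with SOME slack `e` whose
weighted average is small: `|Λ|⁻¹∑_{χ ∉ {0,π̂}} e(χ)·modeTerm(C(χ)) ≤ η`.  With `e = 0`, `A = 4N + ε` this is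
`salmhoferSeilerSmallBeta_of_infraredBound`; the slack may be large on a few modes, or of size `≍ β/D(k)`
in dimension `ν ≥ 5`. [cite: SalmhoferSeiler1991, Thm. 4.8 ((4.40)–(4.42)) with Def. 4.1 (4.3) and (4.14)] -/
theorem salmhoferSeilerSmallBeta_of_infraredBound_slack
    (h : ∀ N ν : ℕ, 1 ≤ N → N ≤ 4 → 4 ≤ ν →
      ∃ A η : ℝ, 0 ≤ A ∧ 2 * A * ComplexSpin.fluctS ν + η < (2 * N : ℝ) ^ 2 / ComplexSpin.sdK N (ComplexSpin.uNLogCoeff N) ∧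
        ∃ β₁ : ℝ, 0 < β₁ ∧ ∃ L₀ : ℕ, ∀ β : ℝ, 0 ≤ β → β < β₁ →
          ∀ (L : ℕ) [NeZero L] (hL : Even L), L₀ ≤ L →
            ∃ e : AddChar (TorusSite ν L) ℂ → ℝ,
              (∀ χ : AddChar (TorusSite ν L) ℂ, -(ν : ℝ) < ComplexSpin.cosSum χ → ComplexSpin.cosSum χ < ν →
                2 * ((ν : ℝ) - ComplexSpin.cosSum χ) *
                    (ComplexSpin.kernelSymbol (fun x y => ssTwoPoint N ν L β 0 x y) χ).re ≤ A + e χ ∧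
                  2 * ((ν : ℝ) + ComplexSpin.cosSum χ) *
                    (-(ComplexSpin.kernelSymbol (fun x y => ssTwoPoint N ν L β 0 x y) χ).re) ≤ A + e χ) ∧
              ((L : ℝ) ^ ν)⁻¹ *
                  ∑ χ ∈ (Finset.univ.erase (0 : AddChar (TorusSite ν L) ℂ)).erase (ComplexSpin.stagChar hL.two_dvd),
                    e χ * ComplexSpin.modeTerm ν (ComplexSpin.cosSum χ) ≤ η) :
    SalmhoferSeilerSmallBeta := by
  refine salmhoferSeilerSmallBeta_of_regularPart fun N ν hN1 hN4 hν => ?_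
  obtain ⟨A, η, hA, hmargin, β₁, hβ₁, L₀, hL₀⟩ := h N ν hN1 hN4 hν
  have hν3 : 3 ≤ ν := by omega
  have hν1 : 1 ≤ ν := by omega
  set b₀ : ℝ := (2 * N : ℝ) ^ 2 / ComplexSpin.sdK N (ComplexSpin.uNLogCoeff N) with hb₀
  set S : ℝ := ComplexSpin.fluctS ν with hS
  -- room `m := b₀ - 2AS - η > 0`; let `S_Λ ≤ S + δ` with `2Aδ ≤ m/2`
  set m : ℝ := b₀ - 2 * A * S - η with hm
  have hmpos : 0 < m := by rw [hm]; linarith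
  obtain ⟨L₁, hL₁⟩ := ComplexSpin.latticeS_tendsto_fluctS (ν := ν) hν3 (ε := m / (4 * A + 4)) (by positivity)
  refine ⟨2 * A * (S + m / (4 * A + 4)) + η, ?_, β₁, hβ₁, max L₀ L₁, fun β hβ hβlt L _ hE hLe => ?_⟩
  · -- `2A(S + δ) + η < b₀`
    have h2 : 2 * A * (m / (4 * A + 4)) ≤ m / 2 := by
      rw [mul_div_assoc', div_le_div_iff₀ (by positivity) (by positivity)]
      nlinarith
    have : 2 * A * (S + m / (4 * A + 4)) + η = 2 * A * S + η + 2 * A * (m / (4 * A + 4)) := by ring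
    rw [this]
    linarith
  · obtain ⟨e, hIR, hη⟩ := hL₀ β hβ hβlt L hE ((le_max_left L₀ L₁).trans hLe)
    have hreg := regularPart_le_of_infraredBound_slack N ν L hν1 hE hIR
    have hSΛ : ComplexSpin.latticeS ν L ≤ S + m / (4 * A + 4) := by
      have := (abs_le.1 (hL₁ L hE ((le_max_right L₀ L₁).trans hLe))).2
      linarith
    have h1 : 2 * A * ComplexSpin.latticeS ν L ≤ 2 * A * (S + m / (4 * A + 4)) :=
      mul_le_mul_of_nonneg_left hSΛ (by positivity)
    linarith

/-! ### Compact QED (`N = 1`) at `β = 0`: the Schwinger–Dyson bound is an EQUALITY, so the regular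
part and the order parameter are complementary -/

/-- **For `N = 1` at `β = 0` the Schwinger–Dyson bound (4.38) is saturated**: on every even torus
`(ℤ/Lℤ)^ν` (`ν ≥ 1`), `∑_μ (T_0(e_μ) + T_0(-e_μ)) = 4 = (2N)²/K(1)` exactly — the SD equation (3.46) with
`L = 0` at `m = 0` has the single term `k = 1` when `N = 1` (`w_1 = 1`): `Z_Λ = ∑_{|y-x|=1} [σ_xσ_y]_Λ`
(equivalently: every dimer cover of the torus covers the origin exactly once).  In the normalisation
`ψ̄ψ = 2σ` of the conjecture this is `4`. [cite: SalmhoferSeiler1991, (3.46) and Thm. 4.8 (4.38) with Remark 4.6 (N = 1)] -/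
theorem ssNbrSum_zero_one_eq_four (ν L : ℕ) [NeZero L] (hν : 1 ≤ ν) (hL : Even L) :
    ∑ μ : Fin ν, (ssTwoPoint 1 ν L 0 0 0 (Pi.single μ 1) + ssTwoPoint 1 ν L 0 0 0 (-Pi.single μ 1)) = 4 := by
  haveI : NeZero ν := ⟨by omega⟩
  set a := ComplexSpin.uNBondCoeff 1 with ha
  set w := ComplexSpin.uNLogCoeff 1 with hw
  have hlog : ComplexSpin.HasLog 1 a w := ComplexSpin.hasLog_uN le_rfl (by norm_num)
  have ha0 : a 0 = 1 := ComplexSpin.uNBondCoeff_zero 1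
  have hw1 : w 1 = 1 := ComplexSpin.uNLogCoeff_one 1
  have hL2 : 2 ≤ L := by obtain ⟨k, hk⟩ := hL; have := NeZero.ne L; omega
  have hapos := hlog.coeff_pos le_rfl ha0 hw1 (fun k hk2 hk1 => by omega)
  set Z := ComplexSpin.partitionFunction (ν := ν) (L := L) 1 0 a with hZdef
  have hZ : 0 < Z :=
    ComplexSpin.partitionFunction_pos hL.two_dvd hL2 hν le_rfl
      (hlog.coeff_nonneg ha0 (fun k hk1 hkN => by rw [show k = 1 by omega, hw1]; exact zero_le_one))
      (hapos 0 (Nat.zero_le 1)) (hapos 1 le_rfl)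
  -- (3.46) with `L = 0`, `N = 1`, `m = 0`: `Z = ∑_{|y|=1} [σ_0σ_y]`
  have hsd := ComplexSpin.partitionFunction_eq_sd' (ν := ν) (L := L) le_rfl hlog hL2 0 (0 : TorusSite ν L)
  have hinner : ∀ s : Fin ν × Bool, ∑ k ∈ Finset.range (1 + 1),
      (k : ℝ) * w k * ComplexSpin.bracket 1 0 a
        ((MvPolynomial.X (0 : TorusSite ν L) * MvPolynomial.X (ComplexSpin.nbr (0 : TorusSite ν L) s)) ^ k) =
      ComplexSpin.bracket 1 0 a
        (MvPolynomial.X (0 : TorusSite ν L) * MvPolynomial.X (ComplexSpin.nbr (0 : TorusSite ν L) s)) := by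
    intro s
    rw [Finset.sum_range_succ, Finset.sum_range_succ, Finset.sum_range_zero, hw1]
    simp
  simp_rw [hinner] at hsd
  rw [mul_zero, zero_mul, zero_add, ComplexSpin.sum_bracket_nbr_zero, ← hZdef] at hsd
  -- the conjecture's normalisation: `T_0(0,z) = 4 [σ_0σ_z]/Z`
  have hterm : ∀ z : TorusSite ν L, ssTwoPoint 1 ν L 0 0 0 z = (2 * 1 : ℝ) ^ 2 / Z * ComplexSpin.twoPt 1 0 a 0 z := by
    intro z
    rw [ssTwoPoint_zero_eq_expect le_rfl hL, ComplexSpin.expect_eq_div, ComplexSpin.twoPt]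
    push_cast
    ring
  simp_rw [hterm, ← mul_add]
  rw [← Finset.mul_sum, ← hsd]
  field_simp
  norm_num

/-- **Hence for `N = 1` at `β = 0` the regular part and the order parameter are complementary**:
`ρ_0(L) = 4 - 4ν · ssChiralOrder 1 ν L 0` on every even torus (`ν ≥ 1`) — all of the `β = 0` margin of
compact QED sits in the infrared estimate `ρ_0(L) ≤ 8 S_Λ(ν)` (`regularPart_zero_le`), i.e.
`4ν · ssChiralOrder 1 ν L 0 ≥ 4 - 8 S_Λ(ν)`. [cite: SalmhoferSeiler1991, Thm. 4.8 ((4.38)–(4.42)) with Remark 4.6 (N = 1)] -/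
theorem regularPart_zero_one_eq (ν L : ℕ) [NeZero L] (hν : 1 ≤ ν) (hL : Even L) :
    ((L : ℝ) ^ ν)⁻¹ *
        ∑ χ ∈ (Finset.univ.erase (0 : AddChar (TorusSite ν L) ℂ)).erase (ComplexSpin.stagChar hL.two_dvd),
          (ComplexSpin.kernelSymbol (fun x y => ssTwoPoint 1 ν L 0 0 x y) χ).re * (2 * ComplexSpin.cosSum χ) =
      4 - 4 * ν * ssChiralOrder 1 ν L 0 := by
  have h := ssNbrSum_eq_order_add_regular 1 ν L hν hL 0
  rw [ssNbrSum_zero_one_eq_four ν L hν hL] at h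
  linarith

/-- **The order parameter of compact QED at `β = 0`, explicitly**: `4ν · ssChiralOrder 1 ν L 0 ≥ 4 - 8 S_Λ(ν)` on
every even torus (`ν ≥ 1`) — (4.41)–(4.42) for `N = 1` with the equality (4.38). [cite: SalmhoferSeiler1991, Thm. 4.8 ((4.38)–(4.42)) with Remark 4.6 (N = 1)] -/
theorem four_nu_mul_ssChiralOrder_zero_one_ge (ν L : ℕ) [NeZero L] (hν : 1 ≤ ν) (hL : Even L) :
    4 - 8 * ComplexSpin.latticeS ν L ≤ 4 * ν * ssChiralOrder 1 ν L 0 := by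
  have h1 := regularPart_zero_one_eq ν L hν hL
  have h2 := regularPart_zero_le 1 ν L le_rfl hν hL
  push_cast at h2
  linarith

end Summit.Ventures.YMGap.Conjectures

end
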